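import Summits.QuantumFields.YangMills.Theorems.BalabanUVNodesN06CutLettersPinsPrintAtRecordPar

/-!
# BalabanUVNodes ∕ N06 ([B9], `Dag.B9_main`) — R1 J-TWIN (KD‴ LEGS): THE CUT CURRENT LETTER `W_E` (3.45)-side AT THE PINS, PRINT's ROUTE, SITE-TRANSPORTER-PARAMETRIC,
# ALONG A SUB-FAMILY `f : J → MemberY …` — the J-twin of ✓`…N06CutLettersPinsPrintAtRecordPar.hWE_of_pins_par` (consumer ✓`…N06WELegAtPinsPhysPUBPar` → its twin)

Track A of `YM-PLAN.md` (cell `pub-ymgap`, HUMAN RULING D-0062), node **N06** = [Balaban1985BackgroundPropagators]; IR-N06-SECTION-2 road **R1** («J-twin of the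
producer cone», ★★★ director-ym №524 (3): authorised in principle, STAGED, sibling files only), `R1-JTWIN-SPEC.md` rule (R)′ (dag-n06-d, 2026-08-31): re-key EXACTLY
the section-tainted ∀-member rows along `f`, keep data ∕ pins ∕ laws ∕ section-free rows member-wide, tainted conclusions along `f` ((R).3′).
Seat `pub-ymgap-dag-n06-d` g30 — own-producer twins under «KD‴».  The parent's second theorem `hletters13_of_pins_par` has no consumer in the cone and is NOT twinned.

WHAT.  `hWE_of_pins_par_J` = the parent's theorem with `{J : Type} (f : J → MemberY d ℓ hd hL b₀ b₁ Mstar)` added after the `H` binder and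
* TAINTED ROW OF THIS TWIN: `h49` — print's (3.49) majorant for `P` (⟸ (3.48) rows 15∕16 via `…N06Proj349AtPinsPhysRCPar`), re-keyed `∀ x : MemberY … ↦ ∀ j : J`,
  read at `f j`;
* LEFT member-wide: the walk facts `hFa hrow`, the pins `hblk12 hblkW12 hDvco12 hDvsco12 hRco12 hparS hGp`, the (3.45)-probe `hp45` and the `pDG` letter `hpDG` (Theorem
  3.3's G₀ layer ∕ Thm 3.7 readers — section-free), the letter families, all x-free numerics ∕ rates ∕ schedules;
* conclusion: the parent's per-member statement (no ∃) `∀ j : J, …` along `f` (needed as a twin only because `h49` enters as a FAMILY binder).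
PROOF: the parent's text by generator (`mkJ.py` over the tree bytes): term-mode `fun x … ↦ fun j …`, member reads `x ↦ f j`, `h49 x ↦ h49 j`; nothing re-derived.
HONEST FRAMING.  Bookkeeping over landed objects; every displayed row is a HYPOTHESIS; nothing of [B9] ∕ [4] asserted; COUNT-NEUTRAL (`--supports stmt-QuantumFields-27239
--as helper`); N06 NOT discharged; K1 NOT closed; under R1 the inner-corner question stays DISPLAYED at the K1 face ∕ NODE O join by (α5); nothing continuum ∕ OS ∕
mass gap ∕ Clay.  0 `def`, 0 `sorry`.  NEW file; the parent untouched.  The member-wide parent is the instance `J := MemberY …`, `f := id`; ORPHAN by design until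
its consumer twin lands (honest).
[cite: Balaban1985BackgroundPropagators, (3.45) p.397, (3.49) p.398, (3.130)–(3.131) pp.421–422, (3.151)–(3.153) p.426; Balaban1984PropagatorsII, Lemma 2.1 (2.60)–(2.61) p.234]
-/

noncomputable section

namespace Summit.QuantumFields.YangMills.BalabanUVNodes.N06CutLettersPinsPrintAtRecordParJ

open Literature.MathematicalPhysics.QuantumFieldTheory.Balaban1983to89
open Literature.MathematicalPhysics.QuantumFieldTheory.Balaban1983to89.Node00 (FBondY IBondY SiteY CfgY SiteParY SiteOpY BondParY parSymY parBY GpY GpPhysY)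
open Literature.MathematicalPhysics.QuantumFieldTheory.Balaban1983to89.Node00.OpsYSectDCoords (DvcoKH DvscoKH RcoK cR39_trBasis_pos)
open Literature.MathematicalPhysics.QuantumFieldTheory.Balaban1983to89.B9Thm39ReadingCoords (cR39)
open Literature.MathematicalPhysics.QuantumFieldTheory.Balaban1983to89.B9Thm34Ext (toB6)
open Literature.MathematicalPhysics.QuantumFieldTheory.Balaban1983to89.B11SectG (HasMaj BlockNorm RowSum)
open Literature.MathematicalPhysics.QuantumFieldTheory.Balaban1983to89.B9Thm312Whole (cNorm GeoOK)
open Literature.MathematicalPhysics.QuantumFieldTheory.Balaban1983to89.B9Thm312WholeClasses (cNormR)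
open Literature.MathematicalPhysics.QuantumFieldTheory.Balaban1983to89.B9RWSums343Holder (HolderProbes)
open Literature.MathematicalPhysics.QuantumFieldTheory.Balaban1983to89.B9RWSums343to347Whole (Facts347)
open Literature.MathematicalPhysics.QuantumFieldTheory.Balaban1983to89.B9CoReadingCoords (XBK blkBK)
open Literature.MathematicalPhysics.QuantumFieldTheory.Balaban1983to89.B9CoReadingCoordsS (XSK sIK blkSK GcoS)
open Literature.MathematicalPhysics.QuantumFieldTheory.Balaban1983to89.B9CoReadingCoordsH (XHK)
open Literature.MathematicalPhysics.QuantumFieldTheory.Balaban1983to89.B9CoReadingCoordsHolder (PK)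
open Literature.MathematicalPhysics.QuantumFieldTheory.Balaban1983to89.B9CoReadingCoordsTranspose (TrIdx trBasis)
open Literature.MathematicalPhysics.QuantumFieldTheory.Balaban1983to89.B9PinMembersKLevelV1 (MemberY geo9Y)
open Literature.MathematicalPhysics.QuantumFieldTheory.Balaban1983to89.B9BackgroundsKLevelV1R (RegFamY bg9YR MemOfFam)
open Literature.MathematicalPhysics.QuantumFieldTheory.Balaban1983to89.B9GeoLemma21KLevelV1 (geo9Y_len_pos geo9Y_dist_triangle geo9Y_dist_comm)
open Literature.MathematicalPhysics.QuantumFieldTheory.Balaban1983to89.B9GeoNormsKLevelV1 (geo9K geo9K_dist_nonneg)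
open Literature.MathematicalPhysics.QuantumFieldTheory.Balaban1983to89.B7Prop2SpecialUnitary (specialUnitaryUnits)
open Literature.MathematicalPhysics.QuantumFieldTheory.Balaban1983to89.B9PerturbationMajorantAlgebra (Proj349Maj)
open Literature.MathematicalPhysics.QuantumFieldTheory.Balaban1983to89.B9PerturbationMajorantsAtLetters (PcoK rcoK_eq)
open Literature.MathematicalPhysics.QuantumFieldTheory.Balaban1983to89.B9PerturbationMajorantsAtLettersPhys (rcoK_GpPhysY)
open Literature.MathematicalPhysics.QuantumFieldTheory.Balaban1983to89.B9MultiscaleSmoothPartitionYNear (rNear)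
open Literature.MathematicalPhysics.QuantumFieldTheory.Balaban1983to89.B9SmoothHolderClassP (bHZKP bHZKPG)
open Literature.MathematicalPhysics.QuantumFieldTheory.Balaban1983to89.B9GradViaDivLettersTransported (taxiB)
open Literature.MathematicalPhysics.QuantumFieldTheory.Balaban1983to89.B9Thm313WholeCutLettersAtPinsP (pWE_bHZKPG_of_pins letters313Zc_bHZKPG_of_pins)
open Literature.MathematicalPhysics.QuantumFieldTheory.Balaban1983to89.B6RandomWalkHom (HasMajorantHom)
open Literature.MathematicalPhysics.QuantumFieldTheory.Balaban1983to89.B9Thm313WholeZ (Letters313Z)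
open Literature.MathematicalPhysics.QuantumFieldTheory.Balaban1983to89.B9Thm313WholeLettersCut (Letters313Zc)
open Literature.MathematicalPhysics.QuantumFieldTheory.Balaban1983to89.B9PerturbationMajorantAlgebra (Thm31GpMaj)
open Literature.MathematicalPhysics.QuantumFieldTheory.Balaban1983to89.B9Thm312Whole (Identities)
open Literature.MathematicalPhysics.QuantumFieldTheory.Balaban1983to89.B9CoReadingCoordsHolder (blkPK probeK wK w₀K)
open Literature.MathematicalPhysics.QuantumFieldTheory.Balaban1983to89.B9CoReadingCoordsHolderAdm (wKA holderProbesKA)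
open Literature.MathematicalPhysics.QuantumFieldTheory.Balaban1983to89.B9LettersHZAtOne (plateau_pos)
open B6GlobalChartV1 (PV blkV1) open B6Ineq2142KLevelV1 (β lvl) open B6Geom246MultiLevelTorus (geomT)
open scoped Matrix.Norms.L2Operator

variable {N : ℕ} {d ℓ : ℕ} {hd : 1 ≤ d + 1} {hL : Odd (ℓ + 1) ∧ 1 < ℓ + 1} {b₀ b₁ : ℝ} {Mstar : ℕ}

/-- ★★ **`hWE` AT THE PIN (P1), member-∀, R-generic** — the certificate's displayed probe letter (Φ^X_β ∇_U G′ R ∇\*_U : `bXH x U → 𝔠_P^{(β−1)}`, every `β ∈ [0,1)`) at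
`bXH x U = bHZKPG … (taxiB … U) wX …` from the (3.45) member for G′ read PRINT-LITERALLY at the print-weighted member `bHZKP … (sch β)` (`hp45`), the (3.43)₁ probe of ∇G′ (`hpDG`), the knit's derived
(3.49) majorant (`h49`) and the pinned letter `R` (`hRco12`; `R = (c_R)⁻¹·(I − P)` by `rcoK_GpPhysY` + `rcoK_eq`), with the budget family `hBx`.
[cite: Balaban1985BackgroundPropagators, Thm 3.13 p.426 + (3.152)–(3.153) p.426 + (3.43)–(3.45) p.398 + (3.49) p.399 + (3.25) p.394; Balaban1984PropagatorsII, (2.51)–(2.56) pp.232–233] -/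
theorem hWE_of_pins_par_J
    (parT : ∀ i : B6KLevelCensusIndexV1.KIdx d ℓ hd hL b₀ b₁, Node00.SiteParY (Matrix (Fin N) (Fin N) ℂ) i) [NeZero N] [∀ x : MemberY d ℓ hd hL b₀ b₁ Mstar, Fintype (geo9Y x).Site]
    {R₁ R₂ : RegFamY d ℓ hd hL b₀ b₁ Mstar (Matrix (Fin N) (Fin N) ℂ)} (H : MemberY d ℓ hd hL b₀ b₁ Mstar → Prop) {J : Type} (f : J → MemberY d ℓ hd hL b₀ b₁ Mstar)
    (bI : ∀ x : MemberY d ℓ hd hL b₀ b₁ Mstar, FBondY x.toKIdx → IBondY x.toKIdx)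
    (hlev : ∀ (x : MemberY d ℓ hd hL b₀ b₁ Mstar) (f : FBondY x.toKIdx), lvl x.hN x.D x.hk (bI x f) = (blkV1 x.hN x.D f).1.1)
    (hβ1 : ∀ (x : MemberY d ℓ hd hL b₀ b₁ Mstar) (f : FBondY x.toKIdx), (geomT x.D).dist (β x.hN x.D x.hk (bI x f)) (blkV1 x.hN x.D f) ≤ 1)
    (hbI0 : ∀ (x : MemberY d ℓ hd hL b₀ b₁ Mstar) (f : FBondY x.toKIdx), bI x f = bI x ⟨f.src, 0⟩)
    (c : ℝ) {M₀ a₀ : ℝ}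
    {dF : ℕ} {δF α L₀ σ cσ : ℝ} (hFa : ∀ x : MemberY d ℓ hd hL b₀ b₁ Mstar, M₀ ≤ (geo9Y x).M → Facts347 (geo9Y x) 1 (H x) dF δF α L₀)
    (hrow : ∀ x : MemberY d ℓ hd hL b₀ b₁ Mstar, M₀ ≤ (geo9Y x).M → RowSum (toB6 (geo9Y x) 1 (H x)) σ cσ)
    (wX : ℝ → ℝ) (hwX₀ : ∀ s, 0 ≤ wX s) (hwX₁ : ∀ s, wX s ≤ 1) (sch : ℝ → ℝ) (hsch0 : ∀ β', 0 ≤ β' → β' < 1 → 0 < sch β') (hsch1 : ∀ β', 0 ≤ β' → β' < 1 → sch β' < 1)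
    (hwsch : ∀ β', 0 ≤ β' → β' < 1 → 0 < wX (sch β'))
    (bXH : ∀ x : MemberY d ℓ hd hL b₀ b₁ Mstar, (bg9YR (Matrix (Fin N) (Fin N) ℂ) (specialUnitaryUnits (Fin N)) R₁ R₂ x).Cfg → BlockNorm (toB6 (geo9Y x) 1 (H x)) (XBK (TrIdx N) x.toKIdx → ℝ))
    (hbXH : ∀ (x : MemberY d ℓ hd hL b₀ b₁ Mstar) (U : (bg9YR (Matrix (Fin N) (Fin N) ℂ) (specialUnitaryUnits (Fin N)) R₁ R₂ x).Cfg), bXH x U =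
      letI : Fintype (geo9K x.toKIdx).Site := (inferInstance : Fintype (geo9Y x).Site);
      bHZKPG (κ := TrIdx N) x.toKIdx (trBasis N) (taxiB x.toKIdx (bg9YR (Matrix (Fin N) (Fin N) ℂ) (specialUnitaryUnits (Fin N)) R₁ R₂ x) (fun U => U) U) (R := (1 : ℝ)) (H := H x) wX hwX₀ hwX₁)
    (𝔬12 : ∀ x : MemberY d ℓ hd hL b₀ b₁ Mstar, B9Thm312Whole.Ops (geo9Y x) (bg9YR (Matrix (Fin N) (Fin N) ℂ) (specialUnitaryUnits (Fin N)) R₁ R₂ x) (XBK (TrIdx N) x.toKIdx) (XBK (TrIdx N) x.toKIdx) (XHK (TrIdx N) x.toKIdx) (XSK (TrIdx N) x.toKIdx))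
    (hblk12 : ∀ x : MemberY d ℓ hd hL b₀ b₁ Mstar, (𝔬12 x).blk = blkBK x.toKIdx (bI x))
    (hblkW12 : ∀ x : MemberY d ℓ hd hL b₀ b₁ Mstar, (𝔬12 x).blkW = blkSK x.toKIdx (sIK x.toKIdx (bI x)))
    (hDvco12 : ∀ (x : MemberY d ℓ hd hL b₀ b₁ Mstar) (U : (bg9YR (Matrix (Fin N) (Fin N) ℂ) (specialUnitaryUnits (Fin N)) R₁ R₂ x).Cfg), (𝔬12 x).Dv U = DvcoKH x.toKIdx (trBasis N) (bg9YR (Matrix (Fin N) (Fin N) ℂ) (specialUnitaryUnits (Fin N)) R₁ R₂ x) (fun U => U) U)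
    (hDvsco12 : ∀ (x : MemberY d ℓ hd hL b₀ b₁ Mstar) (U : (bg9YR (Matrix (Fin N) (Fin N) ℂ) (specialUnitaryUnits (Fin N)) R₁ R₂ x).Cfg), (𝔬12 x).Dvstar U = DvscoKH x.toKIdx (trBasis N) (bg9YR (Matrix (Fin N) (Fin N) ℂ) (specialUnitaryUnits (Fin N)) R₁ R₂ x) (fun U => U) U)
    (hRco12 : ∀ (x : MemberY d ℓ hd hL b₀ b₁ Mstar) (U : (bg9YR (Matrix (Fin N) (Fin N) ℂ) (specialUnitaryUnits (Fin N)) R₁ R₂ x).Cfg), (𝔬12 x).R U = RcoK x.toKIdx (trBasis N) (bg9YR (Matrix (Fin N) (Fin N) ℂ) (specialUnitaryUnits (Fin N)) R₁ R₂ x) (fun U => U) (parT x.toKIdx) (GpPhysY x.toKIdx (parT x.toKIdx)) U)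
    (𝔭A : ∀ x : MemberY d ℓ hd hL b₀ b₁ Mstar, HolderProbes (geo9Y x) (bg9YR (Matrix (Fin N) (Fin N) ℂ) (specialUnitaryUnits (Fin N)) R₁ R₂ x) (XBK (TrIdx N) x.toKIdx) (XBK (TrIdx N) x.toKIdx) (PK (FBondY x.toKIdx) (Fin (d + 1)) (TrIdx N)) (PK (FBondY x.toKIdx) (Fin (d + 1)) (TrIdx N)))
    {CP δP : ℝ} (hCP : 0 ≤ CP) (hδP : δF ≤ δP)
    {parS : ∀ x : MemberY d ℓ hd hL b₀ b₁ Mstar, SiteParY (Matrix (Fin N) (Fin N) ℂ) x.toKIdx} {Gp : ∀ x : MemberY d ℓ hd hL b₀ b₁ Mstar, SiteOpY (Matrix (Fin N) (Fin N) ℂ) x.toKIdx}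
    (hparS : ∀ x : MemberY d ℓ hd hL b₀ b₁ Mstar, parS x = parT x.toKIdx) (hGp : ∀ x : MemberY d ℓ hd hL b₀ b₁ Mstar, Gp x = GpY x.toKIdx (parT x.toKIdx))
    (h49 : ∀ j : J, M₀ ≤ (geo9Y (f j)).M → ∀ α₀ : ℝ, 0 < α₀ → (geo9Y (f j)).M * α₀ ≤ a₀ → ∀ U : (bg9YR (Matrix (Fin N) (Fin N) ℂ) (specialUnitaryUnits (Fin N)) R₁ R₂ (f j)).Cfg, (bg9YR (Matrix (Fin N) (Fin N) ℂ) (specialUnitaryUnits (Fin N)) R₁ R₂ (f j)).Reg335 c α₀ U →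
      Proj349Maj (g := geo9Y (f j)) (blkSK (f j).toKIdx (sIK (f j).toKIdx (bI (f j)))) (blkBK (f j).toKIdx (bI (f j)))
        (PcoK (f j).toKIdx (trBasis N) (bg9YR (Matrix (Fin N) (Fin N) ℂ) (specialUnitaryUnits (Fin N)) R₁ R₂ (f j)) (fun U => U) (parS (f j)) (Gp (f j)) U)
        (DvcoKH (f j).toKIdx (trBasis N) (bg9YR (Matrix (Fin N) (Fin N) ℂ) (specialUnitaryUnits (Fin N)) R₁ R₂ (f j)) (fun U => U) U)
        (DvscoKH (f j).toKIdx (trBasis N) (bg9YR (Matrix (Fin N) (Fin N) ℂ) (specialUnitaryUnits (Fin N)) R₁ R₂ (f j)) (fun U => U) U) 1 (H (f j)) CP δP)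
    {B45 Bh Bx : ℝ → ℝ} {δ45 δh δ₃ : ℝ} (hB45 : ∀ β', 0 ≤ β' → β' < 1 → 0 ≤ B45 β') (hBh : ∀ β', 0 ≤ β' → β' < 1 → 0 ≤ Bh β') (hcσ : 0 ≤ cσ) (hσ : 0 ≤ σ)
    (hbud : 0 ≤ δF - α * δF - 2 * σ) (hδ45 : δF - α * δF - 2 * σ ≤ δ45) (hδh : δF - α * δF - σ ≤ δh) (hδ₃ : δ₃ ≤ δF - α * δF - 2 * σ)
    (hBx : ∀ β', 0 ≤ β' → β' < 1 → (cR39 (trBasis N))⁻¹ * ((wX (sch β'))⁻¹ * B45 β' + Bh β' * (CP * L₀) *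
      ((wX (sch β'))⁻¹ * ((((ℓ + 1 : ℕ) : ℝ)) * Real.exp ((δF - α * δF - σ) * (rNear d ℓ + 1)))) * cσ * cσ) ≤ Bx β')
    (hp45 : ∀ x : MemberY d ℓ hd hL b₀ b₁ Mstar, letI : Fintype (geo9K x.toKIdx).Site := (inferInstance : Fintype (geo9Y x).Site); M₀ ≤ (geo9Y x).M → ∀ α₀ : ℝ, 0 < α₀ → (geo9Y x).M * α₀ ≤ a₀ → ∀ U : (bg9YR (Matrix (Fin N) (Fin N) ℂ) (specialUnitaryUnits (Fin N)) R₁ R₂ x).Cfg, (bg9YR (Matrix (Fin N) (Fin N) ℂ) (specialUnitaryUnits (Fin N)) R₁ R₂ x).Reg335 c α₀ U →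
      (bg9YR (Matrix (Fin N) (Fin N) ℂ) (specialUnitaryUnits (Fin N)) R₁ R₂ x).Reg336 c α₀ U → ∀ (β' : ℝ) (h0 : 0 ≤ β') (h1 : β' < 1),
        HasMaj (bHZKP (κ := TrIdx N) x.toKIdx (trBasis N) (taxiB x.toKIdx (bg9YR (Matrix (Fin N) (Fin N) ℂ) (specialUnitaryUnits (Fin N)) R₁ R₂ x) (fun U => U) U) (R := (1 : ℝ)) (H := H x) (s := sch β') (hsch0 β' h0 h1).le (hsch1 β' h0 h1).le)
          (cNormR 1 (H x) (𝔭A x).blkPX (fun y => (geo9Y_len_pos x y).le) (β' - 1))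
          ((𝔭A x).ΦX U β' ∘ₗ ((𝔬12 x).Dv U ∘ₗ GcoS x.toKIdx (trBasis N) (bg9YR (Matrix (Fin N) (Fin N) ℂ) (specialUnitaryUnits (Fin N)) R₁ R₂ x) (fun U => U) (GpY x.toKIdx (parT x.toKIdx)) U ∘ₗ (𝔬12 x).Dvstar U))
          (fun a b => B45 β' * Real.exp (-(δ45 * (geo9Y x).dist a b))))
    (hpDG : ∀ x : MemberY d ℓ hd hL b₀ b₁ Mstar, letI : Fintype (geo9K x.toKIdx).Site := (inferInstance : Fintype (geo9Y x).Site); M₀ ≤ (geo9Y x).M → ∀ α₀ : ℝ, 0 < α₀ → (geo9Y x).M * α₀ ≤ a₀ → ∀ U : (bg9YR (Matrix (Fin N) (Fin N) ℂ) (specialUnitaryUnits (Fin N)) R₁ R₂ x).Cfg, (bg9YR (Matrix (Fin N) (Fin N) ℂ) (specialUnitaryUnits (Fin N)) R₁ R₂ x).Reg335 c α₀ U →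
      (bg9YR (Matrix (Fin N) (Fin N) ℂ) (specialUnitaryUnits (Fin N)) R₁ R₂ x).Reg336 c α₀ U → ∀ (β' : ℝ), 0 ≤ β' → β' < 1 →
        HasMaj (cNormR 1 (H x) (𝔬12 x).blkW (fun y => (geo9Y_len_pos x y).le) 0) (cNormR 1 (H x) (𝔭A x).blkPX (fun y => (geo9Y_len_pos x y).le) (β' - 1))
          ((𝔭A x).ΦX U β' ∘ₗ (𝔬12 x).Dv U ∘ₗ GcoS x.toKIdx (trBasis N) (bg9YR (Matrix (Fin N) (Fin N) ℂ) (specialUnitaryUnits (Fin N)) R₁ R₂ x) (fun U => U) (GpY x.toKIdx (parT x.toKIdx)) U)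
          (fun a b => Bh β' * Real.exp (-(δh * (geo9Y x).dist a b)))) :
    ∀ j : J, letI : Fintype (geo9K (f j).toKIdx).Site := (inferInstance : Fintype (geo9Y (f j)).Site); M₀ ≤ (geo9Y (f j)).M → ∀ α₀ : ℝ, 0 < α₀ → (geo9Y (f j)).M * α₀ ≤ a₀ → ∀ U : (bg9YR (Matrix (Fin N) (Fin N) ℂ) (specialUnitaryUnits (Fin N)) R₁ R₂ (f j)).Cfg, (bg9YR (Matrix (Fin N) (Fin N) ℂ) (specialUnitaryUnits (Fin N)) R₁ R₂ (f j)).Reg335 c α₀ U →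
      (bg9YR (Matrix (Fin N) (Fin N) ℂ) (specialUnitaryUnits (Fin N)) R₁ R₂ (f j)).Reg336 c α₀ U → ∀ β' : ℝ, 0 ≤ β' → β' < 1 →
        HasMaj (bXH (f j) U) (cNormR 1 (H (f j)) (𝔭A (f j)).blkPX (fun y => (geo9Y_len_pos (f j) y).le) (β' - 1))
          ((𝔭A (f j)).ΦX U β' ∘ₗ ((𝔬12 (f j)).Dv U ∘ₗ GcoS (f j).toKIdx (trBasis N) (bg9YR (Matrix (Fin N) (Fin N) ℂ) (specialUnitaryUnits (Fin N)) R₁ R₂ (f j)) (fun U => U) (GpY (f j).toKIdx (parT (f j).toKIdx)) U ∘ₗ (𝔬12 (f j)).R U ∘ₗ (𝔬12 (f j)).Dvstar U))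
          (fun a b => Bx β' * Real.exp (-(δ₃ * (geo9Y (f j)).dist a b))) := fun j hM α₀ hα ha U hU hU' β' h0 h1 => by
  letI : Fintype (geo9K (f j).toKIdx).Site := (inferInstance : Fintype (geo9Y (f j)).Site)
  have hN : 0 < N := Nat.pos_of_ne_zero (NeZero.ne N)
  have hϱ : 0 ≤ (cR39 (trBasis N))⁻¹ := inv_nonneg.2 (cR39_trBasis_pos hN).le
  -- the pinned letter `R = (c_R)⁻¹·(I − P)` at the SAME `P` as the knit's derived (3.49) majorant
  have hR : (𝔬12 (f j)).R U = (cR39 (trBasis N))⁻¹ • (LinearMap.id -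
      PcoK (f j).toKIdx (trBasis N) (bg9YR (Matrix (Fin N) (Fin N) ℂ) (specialUnitaryUnits (Fin N)) R₁ R₂ (f j)) (fun U => U) (parT (f j).toKIdx) (GpY (f j).toKIdx (parT (f j).toKIdx)) U) := by
    rw [hRco12 (f j) U, rcoK_GpPhysY, rcoK_eq]
  -- the knit's (3.49) majorant read on the ops' carriers
  have h49' : Proj349Maj (𝔬12 (f j)).blkW (𝔬12 (f j)).blk
      (PcoK (f j).toKIdx (trBasis N) (bg9YR (Matrix (Fin N) (Fin N) ℂ) (specialUnitaryUnits (Fin N)) R₁ R₂ (f j)) (fun U => U) (parT (f j).toKIdx) (GpY (f j).toKIdx (parT (f j).toKIdx)) U)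
      ((𝔬12 (f j)).Dv U) ((𝔬12 (f j)).Dvstar U) 1 (H (f j)) CP δP := by
    rw [hblkW12 (f j), hblk12 (f j), hDvco12 (f j) U, hDvsco12 (f j) U, ← hGp (f j), ← hparS (f j)]
    exact h49 j hM α₀ hα ha U hU
  rw [hbXH (f j) U]
  exact pWE_bHZKPG_of_pins (f j).toKIdx (trBasis N) (taxiB (f j).toKIdx (bg9YR (Matrix (Fin N) (Fin N) ℂ) (specialUnitaryUnits (Fin N)) R₁ R₂ (f j)) (fun U => U) U)
    (⟨geo9Y_dist_triangle (f j), geo9Y_dist_comm (f j), geo9K_dist_nonneg (f j).toKIdx, geo9Y_len_pos (f j)⟩ : GeoOK (geo9Y (f j))) (hFa (f j) hM) (hrow (f j) hM) (𝔭A (f j))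
    (P := PcoK (f j).toKIdx (trBasis N) (bg9YR (Matrix (Fin N) (Fin N) ℂ) (specialUnitaryUnits (Fin N)) R₁ R₂ (f j)) (fun U => U) (parT (f j).toKIdx) (GpY (f j).toKIdx (parT (f j).toKIdx)))
    wX hwX₀ hwX₁ (hsch0 β' h0 h1) (hsch1 β' h0 h1) (hwsch β' h0 h1) (hβ1 (f j)) (hlev (f j)) (hbI0 (f j)) (f j).hcfk (hblk12 (f j)) h49' hR
    (hp45 (f j) hM α₀ hα ha U hU hU' β' h0 h1) (hpDG (f j) hM α₀ hα ha U hU hU' β' h0 h1) hϱ hCP (hB45 β' h0 h1) (hBh β' h0 h1) hcσ hσ hδP hbud hδ45 hδh (hBx β' h0 h1) hδ₃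

/-! ## §2 (v1.1) ★★ `hletters13` AT THE PIN (P1): the whole re-cut record `Letters313Zc` member-∀, R-generic (n06-d: «hletters13: DERIVE», edition 56) -/
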